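import Summits.AtomisticToContinuum.HydrodynamicLimit.Theorems.ImplosionDichotomyHydroLimitInBandWindowBalance
import HarnessLib

/-!
# A crude a priori bound on the relative-entropy ledger (S7a of line `IdeatorOneSketch`, crux `HydroLimitInBand`, stmt-9133)

Support file (`--supports stmt-AtomisticToContinuum-9133`) for the crux
`Summit.AtomisticToContinuum.HydrodynamicLimit.Theses.ImplosionDichotomy.HydroLimitInBand`, line
`IdeatorOneSketch`, registered stub `stub_ledgerAprioriBound`, landed UNFOLDED as `ledgerAprioriBound`
(byte-identical with the sibling crux 14680's `stub_ledgerApriori`). Yau's relative-entropy clock runs along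
the explicit reference family `ψ_s = localGibbsLaw σ (ρ_s · Rf(σ³ρ_s)) (u s) (θ s)` built on a classical
hard-sphere Euler solution `(ρ, u, θ)` on `[0, T)`; its Grönwall end needs, for each FIXED `N`, one real `B`
with `KL(lawAt Φ λ_N s ‖ ψ_s) ≤ B` for all `s ∈ [0, t]`, `t < T` (only uniformity in `s` matters).

Proof: the explicit value `EntropyClockDock.toReal_klDiv_lawAt_eq_integral`,
`KL(f_s ‖ ψ_s) = E_λ[G_λ(z) − G_{ψ_s}(Φ_s z)] + log Z_pos(b_s) − log Z_pos(a₀)`, is bounded using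
(a) uniform bounds `0 < m ≤ ρ ≤ M`, `0 < ϑm ≤ θ ≤ Θ`, `‖u‖ ≤ U` on the compact slab `[0, t] × 𝕋³`
(`Torus.IsSmoothSpaceTimeOn.exists_norm_le_of_isCompact`, and the same for the jointly smooth inverse of a
positive field), whence `m ≤ b_s ≤ 2M` for `b_s = ρ_s Rf(σ³ρ_s)`, `1 ≤ Rf ≤ 2` on the packing range;
(b) the pointwise bound `−g_ψ(x, v) ≤ c₀ + |v|²/ϑm` and conservation of the kinetic energy along the flow
(`IsHardSphereTrajectory.configEnergy_eq_holds`), so that `−E_λ[G_{ψ_s}(Φ_s z)] ≤ (N+1)c₀ + ϑm⁻¹ E_λ[Σ|v_i|²]`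
uniformly in `s`; (c) `Z_pos(b_s) ≤ (2M)^{N+1}` (`posWeight_le_pow` on the unit torus); and (d) finiteness
`KL(lawAt Φ λ_N t ‖ ψ_N) < ∞` (re-derived here inside the dock's import closure, cf.
`JaynesSqueezeClosure.klDiv_lawAt_localGibbsLaw_ne_top`: transport to the initial law
`klDiv_lawAt_localGibbsLaw_eq`, positive densities, and the integrable explicit log-ratio
`ae_logRatio_eq_oneBody`) to pass from `toReal` back to `ℝ≥0∞`.
References: H.-T. Yau, Lett. Math. Phys. 22 (1991) §2; S. Olla, S. R. S. Varadhan, H.-T. Yau, Comm. Math.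
Phys. 155 (1993) §3. prover-line-stmt-AtomisticToContinuum-9133-c1-0.
-/

noncomputable section

open MeasureTheory Filter Set Topology InformationTheory
open scoped ENNReal

namespace Summit.AtomisticToContinuum.HydrodynamicLimit.Theorems.EntropyClockDock

open Literature.MathematicalPhysics.KineticTheory Literature.Analysis.FluidPDE
open Literature.Analysis.FunctionSpaces

variable {σ : ℝ} {a₀ θ₀ : T3 → ℝ} {u₀ : T3 → V3}

/-! ### §1 Elementary bounds -/

/-- `Z_pos(b) ≤ Aⁿ` for a continuous one-body weight `0 ≤ b ≤ A` on the unit torus (the hard-core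
indicator is at most one and `𝕋³` has unit volume). [folklore] -/
private theorem posPartition_le_pow_of_le {b : T3 → ℝ} (hb : Continuous b) (hb0 : ∀ x, 0 ≤ b x)
    {A : ℝ} (hA : ∀ x, b x ≤ A) (ε : ℝ) (n : ℕ) : posPartition b ε n ≤ A ^ n := by
  unfold posPartition
  calc ∫ x, posWeight b ε n x ≤ ∫ _x : Fin n → T3, A ^ n :=
        integral_mono (integrable_posWeight hb hb0 ε n) (integrable_const _) fun x =>
          posWeight_le_pow hb0 hA ε x
    _ = A ^ n := by simp

/-- **Pointwise bound on the one-body exponent.** If `m ≤ b`, `ϑm ≤ ϑ ≤ Θ` and `‖w‖ ≤ U` with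
`m, ϑm > 0`, then `−g_ψ(x, v) = −log b(x) + (3/2) log(2πϑ(x)) + |v − w(x)|²/(2ϑ(x)) ≤ c₀ + |v|²/ϑm` with
`c₀ = −log m + (3/2) log(2πΘ) + U²/ϑm`. [folklore] -/
private theorem neg_oneBody_le {b ϑ : T3 → ℝ} {w : T3 → V3} {m ϑm Θ U : ℝ} (hm : 0 < m)
    (hϑm : 0 < ϑm) (hmb : ∀ x, m ≤ b x) (hϑlo : ∀ x, ϑm ≤ ϑ x) (hϑhi : ∀ x, ϑ x ≤ Θ)
    (hwU : ∀ x, ‖w x‖ ≤ U) (x : T3) (v : V3) :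
    -(Real.log (b x) - 3 / 2 * Real.log (2 * Real.pi * ϑ x) - ‖v - w x‖ ^ 2 / (2 * ϑ x)) ≤
      (-Real.log m + 3 / 2 * Real.log (2 * Real.pi * Θ) + U ^ 2 / ϑm) + ϑm⁻¹ * ‖v‖ ^ 2 := by
  have hϑx : 0 < ϑ x := hϑm.trans_le (hϑlo x)
  have h1 : Real.log m ≤ Real.log (b x) := Real.log_le_log hm (hmb x)
  have h2 : Real.log (2 * Real.pi * ϑ x) ≤ Real.log (2 * Real.pi * Θ) :=
    Real.log_le_log (by positivity) (mul_le_mul_of_nonneg_left (hϑhi x) (by positivity))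
  have h3a : ‖v - w x‖ ^ 2 ≤ (‖v‖ + ‖w x‖) ^ 2 :=
    pow_le_pow_left₀ (norm_nonneg _) (norm_sub_le v (w x)) 2
  have h3b : (‖v‖ + ‖w x‖) ^ 2 ≤ 2 * ‖v‖ ^ 2 + 2 * ‖w x‖ ^ 2 := by
    nlinarith [sq_nonneg (‖v‖ - ‖w x‖)]
  have h3c : ‖w x‖ ^ 2 ≤ U ^ 2 := pow_le_pow_left₀ (norm_nonneg _) (hwU x) 2
  have h4 : ‖v - w x‖ ^ 2 / (2 * ϑ x) ≤ (2 * ‖v‖ ^ 2 + 2 * U ^ 2) / (2 * ϑm) :=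
    div_le_div₀ (by positivity) (by linarith) (by positivity) (by linarith [hϑlo x])
  have h5 : (2 * ‖v‖ ^ 2 + 2 * U ^ 2) / (2 * ϑm) = U ^ 2 / ϑm + ϑm⁻¹ * ‖v‖ ^ 2 := by
    field_simp
    ring
  linarith

-- adapted from `HsEulerCalc.exists_pos_le_of_isSmoothSpaceTimeOn`
-- (Literature/MathematicalPhysics/KineticTheory/HardSphereEulerClassicalUniqueness.lean)
/-- A positive jointly smooth scalar field on `[0, T) × 𝕋³` is bounded below by a positive constant on
`[0, t₁] × 𝕋³`, `t₁ < T`: its inverse is jointly smooth, hence bounded on the compact slab. [folklore] -/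
private theorem exists_pos_le_slab {T t₁ : ℝ} {f : ℝ → T3 → ℝ}
    (hf : Torus.IsSmoothSpaceTimeOn (Ico 0 T) f) (hpos : ∀ t ∈ Ico 0 T, ∀ x, 0 < f t x)
    (ht₁ : t₁ < T) : ∃ c, 0 < c ∧ ∀ t ∈ Icc 0 t₁, ∀ x, c ≤ f t x := by
  have hinv : Torus.IsSmoothSpaceTimeOn (Ico 0 T) (fun t x => (f t x)⁻¹) := by
    refine ContDiffOn.inv hf ?_
    rintro ⟨t, y⟩ hp
    exact (hpos t (mem_prod.1 hp).1 _).ne'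
  obtain ⟨K, hK⟩ := hinv.exists_norm_le_of_isCompact isCompact_Icc (Icc_subset_Ico_right ht₁)
  refine ⟨(|K| + 1)⁻¹, by positivity, fun t ht x => ?_⟩
  have hft : 0 < f t x := hpos t ⟨ht.1, ht.2.trans_lt ht₁⟩ x
  have h1 : (f t x)⁻¹ ≤ |K| + 1 := by
    have h := hK t ht x
    rw [Real.norm_eq_abs] at h
    linarith [le_abs_self (f t x)⁻¹, le_abs_self K]
  rw [inv_le_comm₀ (by positivity) hft]
  exact h1

-- adapted from `JaynesSqueezeClosure.klDiv_lawAt_localGibbsLaw_ne_top`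
-- (Theorems/JaynesSqueezeBlockGibbsToRelEntropyLedger.lean), through the dock's transport identity
/-- **The relative entropy of the evolved law with respect to a local Gibbs reference is finite.** For
`σ ≤ 1/2`, continuous positive `(a₀, u₀, θ₀)` and `(b, w, ϑ)`, every flow `Φ` and time `t`:
`KL(lawAt Φ λ_N t ‖ localGibbsLaw σ b w ϑ N Φ) ≠ ∞` — transported to the initial law
(`klDiv_lawAt_localGibbsLaw_eq`: the reference becomes the Liouville density `ρ_ψ ∘ Φ_t`, a.e. positive by
quasi-invariance), `λ_N ≪ (ρ_ψ ∘ Φ_t) dZ`, and the log-likelihood ratio (`llr_withDensity_ae_eq`) is the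
explicit, integrable one-body expression `ae_logRatio_eq_oneBody` (§1 of the window balance file).
[cite: Yau1991, §2] -/
private theorem klDiv_lawAt_localGibbsLaw_ne_top (hσ2 : σ ≤ 1 / 2) (ha : Continuous a₀)
    (hθ : Continuous θ₀) (hu : Continuous u₀) (ha0 : ∀ x, 0 < a₀ x) (hθ0 : ∀ x, 0 < θ₀ x)
    {b ϑ : T3 → ℝ} {w : T3 → V3} (hb : Continuous b) (hϑ : Continuous ϑ) (hw : Continuous w)
    (hb0 : ∀ x, 0 < b x) (hϑ0 : ∀ x, 0 < ϑ x) (N : ℕ)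
    (Φ : HardSphereFlow (Torus.geometry (Fin 3)) (hsDiameter σ N) (N + 1)) (t : ℝ) :
    klDiv (Φ.lawAt (localGibbsLaw σ a₀ u₀ θ₀ N Φ) t) (localGibbsLaw σ b w ϑ N Φ) ≠ ⊤ := by
  -- σ-finiteness of the Liouville measure (instance path made explicit)
  haveI hXE : SigmaFinite (volume : Measure (T3 × V3)) := inferInstance
  haveI hC : SigmaFinite (volume : Measure (Config (N + 1) (Fin 3) T3)) := inferInstance
  haveI hL : SigmaFinite (liouville (Torus.geometry (Fin 3)) (N + 1) (hsDiameter σ N)) := by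
    rw [liouville_eq]; infer_instance
  -- the laws as densities w.r.t. the Liouville measure (definitional), measurability, `toReal ∘ ofReal`
  have hdens : ∀ (a θ : T3 → ℝ) (u : T3 → V3), localGibbsLaw σ a u θ N Φ =
      (liouville (Torus.geometry (Fin 3)) (N + 1) (hsDiameter σ N)).withDensity fun z =>
        ENNReal.ofReal (canonicalDensity (Torus.geometry (Fin 3)) (hsDiameter σ N) (N + 1)
          (localGibbsProfile a u θ) z) := fun a θ u => rfl
  have hm : ∀ {a θ : T3 → ℝ} {u : T3 → V3}, Continuous a → Continuous θ → Continuous u →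
      Measurable fun z => ENNReal.ofReal (canonicalDensity (Torus.geometry (Fin 3)) (hsDiameter σ N)
        (N + 1) (localGibbsProfile a u θ) z) := fun ha hθ hu =>
    (measurable_canonicalDensity _ _ (measurable_localGibbsProfile ha hθ hu)).ennreal_ofReal
  have hto : ∀ {a θ : T3 → ℝ} {u : T3 → V3}, (∀ x, 0 < a x) → (∀ x, 0 < θ x) →
      ∀ z : Config (N + 1) (Fin 3) T3, (ENNReal.ofReal (canonicalDensity (Torus.geometry (Fin 3))
        (hsDiameter σ N) (N + 1) (localGibbsProfile a u θ) z)).toReal =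
        canonicalDensity (Torus.geometry (Fin 3)) (hsDiameter σ N) (N + 1) (localGibbsProfile a u θ) z :=
    fun ha0 hθ0 z => ENNReal.toReal_ofReal (canonicalDensity_localGibbsProfile_nonneg
      (fun x => (ha0 x).le) (fun x => (hθ0 x).le) _ _ _)
  haveI i₀ : IsProbabilityMeasure (localGibbsLaw σ a₀ u₀ θ₀ N Φ) :=
    isProbabilityMeasure_localGibbsLaw ha hθ hu ha0 hθ0 hσ2 N Φ
  haveI i₂ : IsProbabilityMeasure (localGibbsLaw σ b w ϑ N Φ) :=
    isProbabilityMeasure_localGibbsLaw hb hϑ hw hb0 hϑ0 hσ2 N Φ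
  -- integrability of the explicit log-ratio under `λ_N` (one-body sums, §1 of the window balance file)
  have hint : Integrable (fun z =>
      Real.log (canonicalDensity (Torus.geometry (Fin 3)) (hsDiameter σ N) (N + 1)
        (localGibbsProfile a₀ u₀ θ₀) z) -
      Real.log (canonicalDensity (Torus.geometry (Fin 3)) (hsDiameter σ N) (N + 1)
        (localGibbsProfile b w ϑ) (Φ.flow t z))) (localGibbsLaw σ a₀ u₀ θ₀ N Φ) := by
    have hsum := ((integrable_oneBodySum hσ2 ha hθ hu ha0 hθ0 ha hθ hu ha0 hθ0 N Φ).sub'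
      (integrable_oneBodySum_flow hσ2 ha hθ hu ha0 hθ0 hb hϑ hw hb0 hϑ0 N Φ t)).fun_add
      (integrable_const (Real.log (posPartition b (hsDiameter σ N) (N + 1)) -
        Real.log (posPartition a₀ (hsDiameter σ N) (N + 1))))
    have hae := ae_logRatio_eq_oneBody hσ2 a₀ θ₀ u₀ ha hθ hu ha0 hθ0 hb hϑ hw hb0 hϑ0 N Φ t
    exact hsum.congr (hae.mono fun z hz => hz.symm)
  -- transport to the initial law; absolute continuity; the log-likelihood ratio
  rw [klDiv_lawAt_localGibbsLaw_eq (a₀ := a₀) (θ₀ := θ₀) (u₀ := u₀) N Φ hb hϑ hw t, hdens a₀ θ₀ u₀]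
  have hgt : Measurable fun z => ENNReal.ofReal (canonicalDensity (Torus.geometry (Fin 3))
      (hsDiameter σ N) (N + 1) (localGibbsProfile b w ϑ) (Φ.flow t z)) :=
    (hm hb hϑ hw).comp (Φ.measurable_flow t)
  have hgt0 : ∀ᵐ z ∂liouville (Torus.geometry (Fin 3)) (N + 1) (hsDiameter σ N),
      ENNReal.ofReal (canonicalDensity (Torus.geometry (Fin 3)) (hsDiameter σ N) (N + 1)
        (localGibbsProfile b w ϑ) (Φ.flow t z)) ≠ 0 :=
    (Φ.measurePreserving t).quasiMeasurePreserving.ae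
      (ae_canonicalDensity_localGibbsProfile_ne_zero hb hϑ hw hb0 hϑ0 hσ2 N)
  refine klDiv_ne_top_iff.2 ⟨(withDensity_absolutelyContinuous _ _).trans
    (withDensity_absolutelyContinuous' hgt.aemeasurable hgt0), ?_⟩
  refine Integrable.congr ?_ (llr_withDensity_ae_eq _ (hm ha hθ hu) hgt
    (Eventually.of_forall fun z => ENNReal.ofReal_ne_top) hgt0
    (Eventually.of_forall fun z => ENNReal.ofReal_ne_top)).symm
  rw [← hdens]
  refine hint.congr (Eventually.of_forall fun z => ?_)
  simp only [hto ha0 hθ0, hto hb0 hϑ0]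

/-! ### §2 The bound at one time, for a reference with given bounds -/

/-- **`KL(f_t ‖ ψ_N)` bounded in terms of bounds on the reference profiles.** For `σ ≤ 1/2`, continuous
positive `(a₀, u₀, θ₀)` and a continuous reference `ψ = (b, w, ϑ)` with `m ≤ b ≤ A`, `ϑm ≤ ϑ ≤ Θ`,
`‖w‖ ≤ U` (`m, ϑm > 0`):
`KL(lawAt Φ λ_N t ‖ ψ_N) ≤ E_λ[G_λ] + (N+1)c₀ + ϑm⁻¹ E_λ[Σ_i |v_i|²] + (N+1) log A − log Z_pos(a₀)`,
`c₀ = −log m + (3/2) log(2πΘ) + U²/ϑm`, a bound independent of `t` and depending on `ψ` only through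
`(m, A, ϑm, Θ, U)`: the explicit value `toReal_klDiv_lawAt_eq_integral`, the pointwise bound on `−g_ψ`,
conservation of `Σ_i |v_i|²` along the flow (`IsHardSphereTrajectory.configEnergy_eq_holds`) and
`Z_pos(b) ≤ A^{N+1}`; finiteness of the relative entropy converts the real bound into one in `ℝ≥0∞`.
[cite: Yau1991, §2] -/
theorem klDiv_lawAt_le_ofReal_of_profileBounds (hσ2 : σ ≤ 1 / 2) (ha : Continuous a₀)
    (hθ : Continuous θ₀) (hu : Continuous u₀) (ha0 : ∀ x, 0 < a₀ x) (hθ0 : ∀ x, 0 < θ₀ x)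
    {b ϑ : T3 → ℝ} {w : T3 → V3} (hb : Continuous b) (hϑ : Continuous ϑ) (hw : Continuous w)
    {m A ϑm Θ U : ℝ} (hm : 0 < m) (hϑm : 0 < ϑm) (hmb : ∀ x, m ≤ b x) (hbA : ∀ x, b x ≤ A)
    (hϑlo : ∀ x, ϑm ≤ ϑ x) (hϑhi : ∀ x, ϑ x ≤ Θ) (hwU : ∀ x, ‖w x‖ ≤ U) (N : ℕ)
    (Φ : HardSphereFlow (Torus.geometry (Fin 3)) (hsDiameter σ N) (N + 1)) (t : ℝ) :
    klDiv (Φ.lawAt (localGibbsLaw σ a₀ u₀ θ₀ N Φ) t) (localGibbsLaw σ b w ϑ N Φ) ≤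
      ENNReal.ofReal
        ((∫ z, ∑ i, (Real.log (a₀ (z i).1) - 3 / 2 * Real.log (2 * Real.pi * θ₀ (z i).1) -
              ‖(z i).2 - u₀ (z i).1‖ ^ 2 / (2 * θ₀ (z i).1)) ∂(localGibbsLaw σ a₀ u₀ θ₀ N Φ)) +
          ((((N : ℝ) + 1) * (-Real.log m + 3 / 2 * Real.log (2 * Real.pi * Θ) + U ^ 2 / ϑm) +
              ϑm⁻¹ * ∫ z, ∑ i, ‖(z i).2‖ ^ 2 ∂(localGibbsLaw σ a₀ u₀ θ₀ N Φ)) +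
            (((N : ℝ) + 1) * Real.log A - Real.log (posPartition a₀ (hsDiameter σ N) (N + 1))))) := by
  have hb0 : ∀ x, 0 < b x := fun x => hm.trans_le (hmb x)
  have hϑ0 : ∀ x, 0 < ϑ x := fun x => hϑm.trans_le (hϑlo x)
  haveI := isProbabilityMeasure_localGibbsLaw ha hθ hu ha0 hθ0 hσ2 N Φ
  have hne := klDiv_lawAt_localGibbsLaw_ne_top hσ2 ha hθ hu ha0 hθ0 hb hϑ hw hb0 hϑ0 N Φ t
  rw [← ENNReal.ofReal_toReal hne]
  refine ENNReal.ofReal_le_ofReal ?_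
  rw [toReal_klDiv_lawAt_eq_integral hσ2 ha hθ hu ha0 hθ0 hb hϑ hw hb0 hϑ0 N Φ t]
  have hG0 := integrable_oneBodySum hσ2 ha hθ hu ha0 hθ0 ha hθ hu ha0 hθ0 N Φ
  have hGt := integrable_oneBodySum_flow hσ2 ha hθ hu ha0 hθ0 hb hϑ hw hb0 hϑ0 N Φ t
  have hKt := integrable_sum_norm_sq_flow ha hθ hu (fun x => (ha0 x).le) hθ0 σ N Φ t
  rw [integral_sub hG0 hGt]
  -- (b) the flow term: conservation of the kinetic energy and the pointwise bound
  have hK : ∫ z, ∑ i, ‖(Φ.flow t z i).2‖ ^ 2 ∂(localGibbsLaw σ a₀ u₀ θ₀ N Φ) =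
      ∫ z, ∑ i, ‖(z i).2‖ ^ 2 ∂(localGibbsLaw σ a₀ u₀ θ₀ N Φ) := by
    refine integral_congr_ae ?_
    filter_upwards [ae_mem_good_localGibbsLaw σ a₀ θ₀ u₀ N Φ] with z hz
    have hE := IsHardSphereTrajectory.configEnergy_eq_holds (Φ.isTrajectory z hz) t 0
    rw [Φ.flow_zero z hz] at hE
    have h2 : (2 : ℝ) * configEnergy (Φ.flow t z) = 2 * configEnergy z := by rw [hE]
    simpa [configEnergy] using h2
  have hpt : ∀ z : Config (N + 1) (Fin 3) T3,
      -(∑ i, (Real.log (b (Φ.flow t z i).1) - 3 / 2 * Real.log (2 * Real.pi * ϑ (Φ.flow t z i).1) -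
          ‖(Φ.flow t z i).2 - w (Φ.flow t z i).1‖ ^ 2 / (2 * ϑ (Φ.flow t z i).1))) ≤
        ((N : ℝ) + 1) * (-Real.log m + 3 / 2 * Real.log (2 * Real.pi * Θ) + U ^ 2 / ϑm) +
          ϑm⁻¹ * ∑ i, ‖(Φ.flow t z i).2‖ ^ 2 := by
    intro z
    rw [← Finset.sum_neg_distrib, Finset.mul_sum]
    calc ∑ i, -(Real.log (b (Φ.flow t z i).1) - 3 / 2 * Real.log (2 * Real.pi * ϑ (Φ.flow t z i).1) -
            ‖(Φ.flow t z i).2 - w (Φ.flow t z i).1‖ ^ 2 / (2 * ϑ (Φ.flow t z i).1))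
        ≤ ∑ _i : Fin (N + 1), ((-Real.log m + 3 / 2 * Real.log (2 * Real.pi * Θ) + U ^ 2 / ϑm) +
            ϑm⁻¹ * ‖(Φ.flow t z _i).2‖ ^ 2) :=
          Finset.sum_le_sum fun i _ => neg_oneBody_le hm hϑm hmb hϑlo hϑhi hwU _ _
      _ = ((N : ℝ) + 1) * (-Real.log m + 3 / 2 * Real.log (2 * Real.pi * Θ) + U ^ 2 / ϑm) +
            ∑ i, ϑm⁻¹ * ‖(Φ.flow t z i).2‖ ^ 2 := by
          rw [Finset.sum_add_distrib, Finset.sum_const, Finset.card_univ, Fintype.card_fin,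
            nsmul_eq_mul]
          push_cast
          ring
  have hLint : Integrable (fun z : Config (N + 1) (Fin 3) T3 =>
      -(∑ i, (Real.log (b (Φ.flow t z i).1) - 3 / 2 * Real.log (2 * Real.pi * ϑ (Φ.flow t z i).1) -
          ‖(Φ.flow t z i).2 - w (Φ.flow t z i).1‖ ^ 2 / (2 * ϑ (Φ.flow t z i).1))))
      (localGibbsLaw σ a₀ u₀ θ₀ N Φ) := hGt.fun_neg
  have hRint : Integrable (fun z : Config (N + 1) (Fin 3) T3 =>
      ((N : ℝ) + 1) * (-Real.log m + 3 / 2 * Real.log (2 * Real.pi * Θ) + U ^ 2 / ϑm) +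
        ϑm⁻¹ * ∑ i, ‖(Φ.flow t z i).2‖ ^ 2) (localGibbsLaw σ a₀ u₀ θ₀ N Φ) :=
    (integrable_const _).fun_add (hKt.const_mul _)
  have hmono := integral_mono hLint hRint hpt
  have hRHS : ∫ z, (((N : ℝ) + 1) * (-Real.log m + 3 / 2 * Real.log (2 * Real.pi * Θ) + U ^ 2 / ϑm) +
        ϑm⁻¹ * ∑ i, ‖(Φ.flow t z i).2‖ ^ 2) ∂(localGibbsLaw σ a₀ u₀ θ₀ N Φ) =
      ((N : ℝ) + 1) * (-Real.log m + 3 / 2 * Real.log (2 * Real.pi * Θ) + U ^ 2 / ϑm) +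
        ϑm⁻¹ * ∫ z, ∑ i, ‖(z i).2‖ ^ 2 ∂(localGibbsLaw σ a₀ u₀ θ₀ N Φ) := by
    rw [integral_add (integrable_const _) (hKt.const_mul _), integral_const, probReal_univ, one_smul,
      integral_const_mul, hK]
  rw [integral_neg] at hmono
  -- (c) the configurational partition function of the reference
  have hZ : Real.log (posPartition b (hsDiameter σ N) (N + 1)) ≤ ((N : ℝ) + 1) * Real.log A := by
    calc Real.log (posPartition b (hsDiameter σ N) (N + 1)) ≤ Real.log (A ^ (N + 1)) :=
          Real.log_le_log (posPartition_pos hb hb0 hσ2 N)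
            (posPartition_le_pow_of_le hb (fun x => (hb0 x).le) hbA _ _)
      _ = ((N : ℝ) + 1) * Real.log A := by
          rw [Real.log_pow]
          push_cast
          ring
  linarith

/-! ### §3 The registered stub `stub_ledgerAprioriBound`, unfolded -/

/-- **S7a = `ledgerAprioriBound` of line `IdeatorOneSketch` (crux `HydroLimitInBand`,
stmt-AtomisticToContinuum-9133; verbatim the sibling crux 14680's `stub_ledgerApriori`).** For the
hard-sphere system on `𝕋³` at `0 < σ < 1/2` started from `λ_N = localGibbsLaw σ a₀ u₀ θ₀ N Φ`, a classical
hard-sphere Euler solution `(ρ, u, θ)` on `[0, T)`, `t ∈ (0, T)` with the packing `ρ_s σ³ < r` on `[0, t]`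
and a continuous factor `1 ≤ Rf ≤ 2` on `[0, r]`: for every `N` and flow `Φ` there is ONE real `B` with
`KL(lawAt Φ λ_N s ‖ localGibbsLaw σ (ρ_s Rf(σ³ρ_s)) (u s) (θ s) N Φ) ≤ B` for all `s ∈ [0, t]` — the
reference profiles obey uniform bounds `m ≤ ρ ≤ M`, `ϑm ≤ θ ≤ Θ`, `‖u‖ ≤ U` on the compact slab
`[0, t] × 𝕋³` (joint smoothness of the classical solution), so `m ≤ b_s ≤ 2M`, and
`klDiv_lawAt_le_ofReal_of_profileBounds` applies at every `s` with the same constants. [cite: Yau1991, §2] -/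
theorem ledgerAprioriBound :
  ∀ (r : ℝ) (Rf : ℝ → ℝ), 0 < r → (∀ x ∈ Icc 0 r, 1 ≤ Rf x ∧ Rf x ≤ 2) → ContinuousOn Rf (Icc 0 r) →
    ∀ (a₀ θ₀ : T3 → ℝ) (u₀ : T3 → V3), Continuous a₀ → Continuous θ₀ → Continuous u₀ →
      (∀ x, 0 < a₀ x) → (∀ x, 0 < θ₀ x) →
      ∀ σ : ℝ, 0 < σ → σ < 1 / 2 →
        ∀ (T : ℝ) (ρ θ : ℝ → T3 → ℝ) (u : ℝ → T3 → V3), IsHardSphereEulerSolution σ T ρ u θ →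
          ∀ t ∈ Set.Ioo 0 T, (∀ s ∈ Set.Icc 0 t, ∀ x, ρ s x * σ ^ 3 < r) →
            ∀ (N : ℕ) (Φ : HardSphereFlow (Torus.geometry (Fin 3)) (hsDiameter σ N) (N + 1)),
              ∃ B : ℝ, ∀ s ∈ Set.Icc 0 t,
                klDiv (Φ.lawAt (localGibbsLaw σ a₀ u₀ θ₀ N Φ) s)
                  (localGibbsLaw σ (fun x => ρ s x * Rf (σ ^ 3 * ρ s x)) (u s) (θ s) N Φ) ≤ ENNReal.ofReal B := by
  intro r Rf _hr hRf hRfc a₀ θ₀ u₀ ha hθ hu ha0 hθ0 σ hσ hσ2 T ρ θ u hE t ht hpack N Φ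
  have hσ2' : σ ≤ 1 / 2 := hσ2.le
  have htT : Icc 0 t ⊆ Ico 0 T := Icc_subset_Ico_right ht.2
  -- (a) uniform bounds on the compact slab `[0, t] × 𝕋³`
  obtain ⟨M, hM⟩ := hE.smooth_density.exists_norm_le_of_isCompact isCompact_Icc htT
  obtain ⟨m, hm0, hm⟩ := exists_pos_le_slab hE.smooth_density hE.density_pos ht.2
  obtain ⟨Θ, hΘ⟩ := hE.smooth_temperature.exists_norm_le_of_isCompact isCompact_Icc htT
  obtain ⟨ϑm, hϑm0, hϑm⟩ := exists_pos_le_slab hE.smooth_temperature hE.temperature_pos ht.2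
  obtain ⟨U, hU⟩ := hE.smooth_velocity.exists_norm_le_of_isCompact isCompact_Icc htT
  refine ⟨(∫ z, ∑ i, (Real.log (a₀ (z i).1) - 3 / 2 * Real.log (2 * Real.pi * θ₀ (z i).1) -
        ‖(z i).2 - u₀ (z i).1‖ ^ 2 / (2 * θ₀ (z i).1)) ∂(localGibbsLaw σ a₀ u₀ θ₀ N Φ)) +
      ((((N : ℝ) + 1) * (-Real.log m + 3 / 2 * Real.log (2 * Real.pi * Θ) + U ^ 2 / ϑm) +
          ϑm⁻¹ * ∫ z, ∑ i, ‖(z i).2‖ ^ 2 ∂(localGibbsLaw σ a₀ u₀ θ₀ N Φ)) +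
        (((N : ℝ) + 1) * Real.log (2 * M) - Real.log (posPartition a₀ (hsDiameter σ N) (N + 1)))),
    fun s hs => ?_⟩
  have hsT : s ∈ Ico 0 T := htT hs
  have hρc : Continuous (ρ s) := (hE.smooth_density.isSmooth_slice hsT).continuous
  have hρ0 : ∀ x, 0 < ρ s x := hE.density_pos s hsT
  have hmem : ∀ x, σ ^ 3 * ρ s x ∈ Icc 0 r := fun x =>
    ⟨(mul_pos (pow_pos hσ 3) (hρ0 x)).le, by rw [mul_comm]; exact (hpack s hs x).le⟩
  have hρM : ∀ x, ρ s x ≤ M := fun x =>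
    (le_abs_self _).trans (by simpa only [Real.norm_eq_abs] using hM s hs x)
  have hM0 : 0 ≤ M := (norm_nonneg _).trans (hM s hs (0 : T3))
  have hσρc : Continuous fun x => σ ^ 3 * ρ s x := continuous_const.mul hρc
  refine klDiv_lawAt_le_ofReal_of_profileBounds hσ2' ha hθ hu ha0 hθ0
    (b := fun x => ρ s x * Rf (σ ^ 3 * ρ s x)) (A := 2 * M)
    (hρc.mul (hRfc.comp_continuous hσρc hmem))
    (hE.smooth_temperature.isSmooth_slice hsT).continuous
    (hE.smooth_velocity.isSmooth_slice hsT).continuous hm0 hϑm0 (fun x => ?_) (fun x => ?_)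
    (hϑm s hs) (fun x => ?_) (hU s hs) N Φ s
  · exact (hm s hs x).trans (le_mul_of_one_le_right (hρ0 x).le (hRf _ (hmem x)).1)
  · calc ρ s x * Rf (σ ^ 3 * ρ s x) ≤ M * 2 :=
          mul_le_mul (hρM x) (hRf _ (hmem x)).2 (zero_le_one.trans (hRf _ (hmem x)).1) hM0
      _ = 2 * M := mul_comm _ _
  · exact (le_abs_self _).trans (by simpa only [Real.norm_eq_abs] using hΘ s hs x)

end Summit.AtomisticToContinuum.HydrodynamicLimit.Theorems.EntropyClockDock

end
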